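import Summits.QuantumFields.YangMills.Theorems.BalabanUVNodesN27AtRecord13CoPHHolder
import Summits.QuantumFields.YangMills.Theorems.BalabanUVNodesN27AtAdmReadingOfRecord13CoPH
import Summits.QuantumFields.YangMills.Theorems.BalabanUVNodesN15AtReadingOfRecord13CoPHC2Bg
import Summits.QuantumFields.YangMills.Theorems.BalabanUVNodesN14AtRateRecord13CoPHOn

/-!
# BalabanUVNodes ∕ N27 = binder B5 AT THE RECORD — THE K3⁷ REDUCTION AT node00-def-W1's ADMISSIBLE `CoPH` READING WITH EVERY K4 RATE SLOT IN ITS PRODUCER's DEEPEST LANDED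
# CURRENCY **AND NODE N16 IN ITS CURRENCY OF RECORD «R-β»** (plan g77 YMPLAN-G77-N16-PICK (B), I.23344): the R-β twin of (N) `…N27AtAdmReadingOfRecord13CoPHProducers` §2 —
# N14 ⟸ END-B uniform leaves (dag-n14-c∕-a), N15 ⟸ the reading equation onto dag-n15-a∕-c's primitive-carrier family with the U-seeing unit layer (U-E), N16 AT EXPONENT `β` ⟸
# node N06's Theorem 3.3 + dag-n06-b's dictionary with the Hölder binder at exponent `β` + the [4] letters + N07's linear leaf, letters PRODUCED (dag-n16-e 40ᴮ §2), N17 eliminated,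
# N18 in CLOSED FORM on the admissible tables, N22 ⟸ N18 (dag-n22-e 8a″ STRIP), (D4), the K5 side, the N19′ edge reading dag-n16-e 41ᴴ's `RatesHolderAt … β` for every `ℓ₃`;
# over (Q) `…N27AtRecord13CoPHHolder` §2 `spine_rec13CCoPHOn_at_readingOfRecord₁₃CoPH_holder`
# (cell `pub-ymgap`, HUMAN RULING D-0062 Track A, R134 seat `pub-ymgap-dag-n27-c` (s2) gen 10; K3⁷ `SpineGivenEndpointR13SepCoPH` = stmt-QuantumFields-20544, `--kind proof --supports
# 20544 --as helper`; COUNT-NEUTRAL; THEOREMS ONLY, 0 `def`, 0 `sorry`; `N`-generic, regime-generic, NO Theses import — the item-facing face is leaf F `…N27SpineGivenEndpointR13SepCoPHHolderProducers`)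

WHAT IS KERNEL-CHECKED ([bookkeeping]; ONE theorem): ★★ `spine_rec13CCoPHOn_at_readingAdm₁₃CoPH_holder_of_uniformLeaves_c2Bg_thm33Letters` — (N) §2's regime theorem with `h19`'s
antecedent `RatesAt ↦ RatesHolderAt … β`, the N16 supplier 40ᴮ §1 ↦ §2 (`hβ0 hβ1`, the dictionary's Hölder binder at exponent `β`), the base knit XLᶜᵒᵖᴴ ↦ (Q) §2; §0's N16 inputs are 40ᴮ
§2's binders VERBATIM as section variables; the c2Bg family's lattice directions are named `α α'` here (the letter `β` is node N16's Hölder exponent).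

HONEST FRAMING.  COMPOSITE-node bookkeeping BY NAME; no estimate; EVERY displayed antecedent is a HYPOTHESIS inhabited for no family today (END-B uniform leaves on the residual dressed
tower; the MODEL-level reading equation `hne2`; Thm 3.3 ∕ dictionary ∕ letters ∕ `LeafH3sup`; W1's table letters and numerals; the N18 closed-form bound; (D4); the K5 stubs; the N19′
edge at exponent β); β a LETTER in `[0, 1]` (the consumers' window `2∕3 < β < 1` lies inside and is theirs); NE3 at exponent β and every other estimate NOT PROVED; nothing of Bałaban's
asserted or instantiated; no `Provisos₁₃CoPH` inhabitant claimed (K0⁷ open); N14 ∕ N15 ∕ N16 ∕ N18 ∕ N22 ∕ N27 NOT discharged; K3⁷ NOT claimed; counts UNMOVED (typed 28∕28 ·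
discharged 5∕27, A 5∕28); one finite four-torus programme at fixed `ε` — NOT ℝ⁴, NOT infinite volume, NOT OS, NOT a mass gap, NOT Clay.  No decl below carries a cite tag.
-/

set_option autoImplicit false

namespace Summit.QuantumFields.YangMills.Theorems.BalabanUVNodesN27SpineRecord

open Set Metric
open scoped Matrix.Norms.L2Operator

open Literature.MathematicalPhysics.QuantumFieldTheory.Balaban1983to89
open Literature.MathematicalPhysics.QuantumFieldTheory.Balaban1983to89.T4Continuum
open Literature.MathematicalPhysics.QuantumFieldTheory.Balaban1983to89.T4OutputRate (Carriers Functional NE5 DecayBound Window)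
open Literature.MathematicalPhysics.QuantumFieldTheory.Balaban1983to89.TreeLengthTorus (TDom tsys torusTreeLen)
open Literature.MathematicalPhysics.QuantumFieldTheory.Balaban1983to89.T4InputCauchyRateData (StepModel)
open Literature.MathematicalPhysics.QuantumFieldTheory.Balaban1983to89.B13Resummation (locE)
open Literature.MathematicalPhysics.QuantumFieldTheory.Balaban1983to89.TreeLengthTorusGeometry (TTouch)
open Literature.MathematicalPhysics.QuantumFieldTheory.Balaban1983to89.B12TreeDecay (K₀)
open Summit.QuantumFields.BalabanUV.T4Continuum.Spine.NE5
open YMDAG.N18.HLayer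
open YMDAG.N18.W1Reading (s_N18_rRec₁₃CoPH_readingAdm_of_envelope_bound238_pin n18At_u3OfRecord₁₃_readingAdm_iff)
open T4ContinuumYM4Torus (ForSmallCouplings)
open Summit.QuantumFields.BalabanUV.T4Continuum.Spine
open YMDAG.UVSplit
open Node00 (Stage13HParams datumOfRecord₁₃CoPH IsRecordOfRecord₁₃CCoPH IsDatumOfRecord₁₃CCoPH NE3Letters₁₁ NE2Objects₁₁ ne3ConstLayerOfRecord₁₁ MatA ιSU prependCoupling)
open Node00.Sect2 (domCount domSys CPair ofBackgroundC)
open Node00.W1 (ReadingData LevelPairing LetterInputs ClusterTower pairOfRecord functionalC termC box SpRestr AdmBg)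
open YMDAG.N22 (s_N22_readingOfRecord₁₃CoPH_ofRecordAdm_of_s_N18_analytic s_N22_readingOfRecord₁₃CoPHOn_ofRecordAdm_of_s_N18_stripBound)
open B7Prop1Explicit B7Prop2Explicit
open B8Ineq132 (InAk covDerivFwd)
open B8LeafModelZd (ZdIdx)
open B8SockLettersRD (SockLettersRD)
open B7Eq78Linearization (zdBlocking QprimeIter)
open B8Eq119TwistedAxial (bgT)
open B8Eq140Level (SideTouches)
open B8Eq138LandauZd (covLap QT)
open B8Eq1117Concrete (XSpace)
open B8Prop5ContractionKLevel (Bd2)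
open B8LambdaSpaceKLevel (wt)
open B9SupplySockB9P3ZdLetters (OpsZd)
open B9SupplySockB9P3ZdAt (DictAt Prop6At InvAt CurvAt LandauAt AvgAt HolderAt)
open Node00 (ne3NperOfRecord₁₁ ne3DomOfRecord₁₁)
open Summit.QuantumFields.BalabanUV.T4Continuum.NE3.LeafIndexSockets (LeafH3sup)
open Summit.QuantumFields.BalabanUV.T4Continuum.NE1p.DressedRoot (UniformConstants BookingLeaves)
open YMDAG.N14 (n14At_of_uniformLeaves s_N14_rRec₁₃CoPHOn_of_uniformLeaves)
open Summit.QuantumFields.YangMills.BalabanUVNodes.N15.AtKeyedHome (neZero_blockFactor)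
open Summit.QuantumFields.YangMills.BalabanUVNodes.N15.UnitLayerBg (c2BgObjects)
open Summit.QuantumFields.YangMills.BalabanUVNodes.N15.AtReadingOfRecord13CoPH (s_N15_readingOfRecord₁₃CoPH_of_c2Bg_family s_N15_readingOfRecord₁₃CoPHOn_of_c2Bg_family)
open Summit.QuantumFields.YangMills.BalabanUVNodes.SpineRatesHolder (RatesHolderAt)
open Summit.QuantumFields.YangMills.BalabanUVNodes.N16OfThm33LettersAllTorusAtRecord13CoPH (exists_letters_s_N16Holder_readingOfRecord₁₃CoPHOn_of_thm33Letters_allTorus)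

variable {N : ℕ} [NeZero N] (cr : SpineReading₁₃CoPH N) {β : ℝ} (hβ0 : 0 ≤ β) (hβ1 : β ≤ 1)

/-! ## §0 The N16 supplier's inputs at exponent `β` (dag-n16-e 40ᴮ §2, VERBATIM; as in (Q) §3) -/

variable {g₃ : T4Family → ℝ} (hg₃ : ∀ F, 0 < g₃ F)
  (hD : ∀ F : T4Family, letI : CStarAlgebra (Matrix (Fin N) (Fin N) ℂ) := {}
      ∃ (len : Site 4 → ℝ) (I : Type) (geo : I → B9.Geometry) (bg : I → B9.Backgrounds) (GA Gp : ∀ i, B9.KernelFamily (geo i) (bg i)) (c35 : ℝ)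
        (mem : ℝ → ZdIdx 4 F.L → ℕ → I)
        (ιCfg : ∀ (M : ℝ) (i : ZdIdx 4 F.L) (m : ℕ) (U₀ : Site 4 → Fin 4 → (Matrix (Fin N) (Fin N) ℂ)ˣ), (∀ x κ, U₀ x κ ∈ unitaryUnits (Matrix (Fin N) (Fin N) ℂ)) → (bg (mem M i m)).Cfg)
        (ιLoc : ∀ (M : ℝ) (i : ZdIdx 4 F.L) (m : ℕ), (Site 4 → Fin 4 → Matrix (Fin N) (Fin N) ℂ) → (geo (mem M i m)).Loc)
        (ops : ℝ → ZdIdx 4 F.L → ℕ → OpsZd 4 (Matrix (Fin N) (Fin N) ℂ)) (c₆ K₆ M₃ a₃ c69 q CH B₀'H B₂' BG BR cL : ℝ),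
        (∀ v : Site 4, 0 < len v → 1 ≤ len v) ∧ (∀ μ : Fin 4, len (e μ) = 1) ∧
        B9.Thm33Printed c35 geo bg Gp GA ∧
        0 < c₆ ∧ 0 < K₆ ∧ 0 < a₃ ∧ 0 ≤ c69 ∧ 0 ≤ q ∧ 0 < B₀'H ∧ 0 ≤ B₂' ∧ 0 ≤ BG ∧ 0 ≤ BR ∧ 0 < cL ∧
        (∀ (M : ℝ) (i : {i : ZdIdx 4 F.L // (∀ j, i.Ω j = Set.univ) ∧ (∀ m j, i.Λs m j = {_y | j = m}) ∧ (∀ m j, i.Λb m j = {_c | j = m}) ∧ i.η = ((F.L : ℝ)⁻¹) ^ i.k}) (m : ℕ), DictAt geo bg GA F.L mem ιCfg ιLoc ops M i.1 m) ∧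
        (∀ (M : ℝ) (i : {i : ZdIdx 4 F.L // (∀ j, i.Ω j = Set.univ) ∧ (∀ m j, i.Λs m j = {_y | j = m}) ∧ (∀ m j, i.Λb m j = {_c | j = m}) ∧ i.η = ((F.L : ℝ)⁻¹) ^ i.k}) (m : ℕ), M₃ ≤ M → Prop6At bg F.L mem ιCfg c35 c₆ K₆ M i.1 m) ∧
        (∀ (M : ℝ) (i : {i : ZdIdx 4 F.L // (∀ j, i.Ω j = Set.univ) ∧ (∀ m j, i.Λs m j = {_y | j = m}) ∧ (∀ m j, i.Λb m j = {_c | j = m}) ∧ i.η = ((F.L : ℝ)⁻¹) ^ i.k}) (m : ℕ), M₃ ≤ M → InvAt bg F.L mem ιCfg ops c35 a₃ M i.1 m) ∧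
        (∀ (M : ℝ) (i : {i : ZdIdx 4 F.L // (∀ j, i.Ω j = Set.univ) ∧ (∀ m j, i.Λs m j = {_y | j = m}) ∧ (∀ m j, i.Λb m j = {_c | j = m}) ∧ i.η = ((F.L : ℝ)⁻¹) ^ i.k}) (m : ℕ), M₃ ≤ M → CurvAt bg F.L mem ιCfg ops c35 a₃ c69 M i.1 m) ∧
        (∀ (M : ℝ) (i : {i : ZdIdx 4 F.L // (∀ j, i.Ω j = Set.univ) ∧ (∀ m j, i.Λs m j = {_y | j = m}) ∧ (∀ m j, i.Λb m j = {_c | j = m}) ∧ i.η = ((F.L : ℝ)⁻¹) ^ i.k}) (m : ℕ), M₃ ≤ M → LandauAt bg F.L mem ιCfg ops c35 a₃ M i.1 m) ∧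
        (∀ (M : ℝ) (i : {i : ZdIdx 4 F.L // (∀ j, i.Ω j = Set.univ) ∧ (∀ m j, i.Λs m j = {_y | j = m}) ∧ (∀ m j, i.Λb m j = {_c | j = m}) ∧ i.η = ((F.L : ℝ)⁻¹) ^ i.k}) (m : ℕ), AvgAt F.L ops q M i.1 m) ∧
        (∀ (M : ℝ) (i : {i : ZdIdx 4 F.L // (∀ j, i.Ω j = Set.univ) ∧ (∀ m j, i.Λs m j = {_y | j = m}) ∧ (∀ m j, i.Λb m j = {_c | j = m}) ∧ i.η = ((F.L : ℝ)⁻¹) ^ i.k}) (m : ℕ), HolderAt geo bg GA F.L mem ιCfg ops β len CH M i.1 m) ∧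
        (∀ i : {i : ZdIdx 4 F.L // (∀ j, i.Ω j = Set.univ) ∧ (∀ m j, i.Λs m j = {_y | j = m}) ∧ (∀ m j, i.Λb m j = {_c | j = m}) ∧ i.η = ((F.L : ℝ)⁻¹) ^ i.k}, SockLettersRD (𝔸 := Matrix (Fin N) (Fin N) ℂ) F.L BG BR B₀'H B₂' cL i.1.η i.1.k i.1.Ω i.1.Λs) ∧
        (∀ i : {i : ZdIdx 4 F.L // (∀ j, i.Ω j = Set.univ) ∧ (∀ m j, i.Λs m j = {_y | j = m}) ∧ (∀ m j, i.Λb m j = {_c | j = m}) ∧ i.η = ((F.L : ℝ)⁻¹) ^ i.k}, ∀ α₀ : ℝ, 0 < α₀ → α₀ ≤ cL → ∀ U₀ : Site 4 → Fin 4 → (Matrix (Fin N) (Fin N) ℂ)ˣ, (∀ x κ, U₀ x κ ∈ unitaryUnits (Matrix (Fin N) (Fin N) ℂ)) →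
          InAk F.L i.1.k i.1.η α₀ i.1.Ω U₀ →
          ∃ (g Δ : (Site 4 → Matrix (Fin N) (Fin N) ℂ) →ₗ[ℂ] (Site 4 → Matrix (Fin N) (Fin N) ℂ)) (q : (Site 4 → Matrix (Fin N) (Fin N) ℂ) →ₗ[ℂ] (ℕ → Site 4 → Matrix (Fin N) (Fin N) ℂ))
            (qs : (ℕ → Site 4 → Matrix (Fin N) (Fin N) ℂ) →ₗ[ℂ] (Site 4 → Matrix (Fin N) (Fin N) ℂ)) (Aw c : (ℕ → Site 4 → Matrix (Fin N) (Fin N) ℂ) →ₗ[ℂ] (ℕ → Site 4 → Matrix (Fin N) (Fin N) ℂ))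
            (H' : XSpace 4 i.1.k (Matrix (Fin N) (Fin N) ℂ) →ₗ[ℂ] (Site 4 → Matrix (Fin N) (Fin N) ℂ)),
            (∀ x : Site 4 → Matrix (Fin N) (Fin N) ℂ, (∃ C : ℝ, ∀ y, ‖x y‖ ≤ C) → g (Δ x + qs (Aw (q x))) = x) ∧ (∀ φ, qs (c (q (g (g (qs φ))))) = qs φ) ∧
            (∀ (f : Site 4 → Matrix (Fin N) (Fin N) ℂ), ∀ x ∈ i.1.Ω 0, Δ f x = covLap i.1.η U₀ ((i.1.Ω 0).indicator f) x) ∧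
            (∀ (μ : ℕ → Site 4 → Matrix (Fin N) (Fin N) ℂ), ∀ x ∈ i.1.Ω 0, qs μ x = QT F.L i.1.k (i.1.Λs i.1.k) U₀ μ x) ∧
            (∀ (f : Site 4 → Matrix (Fin N) (Fin N) ℂ) (n : ℕ), n ≤ i.1.k → ∀ y ∈ i.1.Λs i.1.k n, q f n y = QprimeIter (zdBlocking 4 F.L) (bgT F.L U₀) n f y) ∧
            (∀ (f : Site 4 → Matrix (Fin N) (Fin N) ℂ) (n : ℕ) (y : Site 4), ¬ (n ≤ i.1.k ∧ y ∈ i.1.Λs i.1.k n) → q f n y = 0) ∧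
            (∀ (X : XSpace 4 i.1.k (Matrix (Fin N) (Fin N) ℂ)) (x : Site 4), ‖H' X x‖ ≤ B₀'H * ‖X‖) ∧
            (∀ n, n ≤ i.1.k → ∀ (X : XSpace 4 i.1.k (Matrix (Fin N) (Fin N) ℂ)), ∀ p ∈ {b : Site 4 × Fin 4 | SideTouches (i.1.Ω n) b.1 b.2},
              wt F.L i.1.η n * ‖covDerivFwd i.1.η U₀ p.2 (H' X) p.1‖ ≤ B₀'H * ‖X‖) ∧
            (∀ X : XSpace 4 i.1.k (Matrix (Fin N) (Fin N) ℂ), Bd2 F.L i.1.η i.1.k i.1.Ω (covLap i.1.η U₀ (H' X)) (B₂' * ‖X‖)) ∧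
            (∀ (Y : XSpace 4 i.1.k (Matrix (Fin N) (Fin N) ℂ)) (n : ℕ) (hn : n ≤ i.1.k) (y : Site 4), y ∈ i.1.Λs i.1.k n →
              QprimeIter (zdBlocking 4 F.L) (bgT F.L U₀) n (H' Y) y = Y (⟨n, Nat.lt_succ_of_le hn⟩, y)) ∧
            (∀ (f : Site 4 → Matrix (Fin N) (Fin N) ℂ) (r : ℝ), 0 ≤ r → Bd2 F.L i.1.η i.1.k i.1.Ω f r →
              (∀ x, ‖g f x‖ ≤ BG * r) ∧ ∀ n, n ≤ i.1.k → ∀ p ∈ {b : Site 4 × Fin 4 | SideTouches (i.1.Ω n) b.1 b.2},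
                wt F.L i.1.η n * ‖covDerivFwd i.1.η U₀ p.2 (g f) p.1‖ ≤ BG * r) ∧
            (∀ (f : Site 4 → Matrix (Fin N) (Fin N) ℂ) (r : ℝ), 0 ≤ r → Bd2 F.L i.1.η i.1.k i.1.Ω f r → Bd2 F.L i.1.η i.1.k i.1.Ω (f - g (qs (c (q (g f))))) (BR * r))))
  (h7 : ∀ F : T4Family, ∃ C ε₀ : ℝ, 0 ≤ C ∧ 0 < ε₀ ∧ ∀ ε : ℝ, 0 < ε → ε ≤ ε₀ →
      LeafH3sup 4 F.L (ne3NperOfRecord₁₁ F 0 0) ε (C * ε) (C * ε) (ne3DomOfRecord₁₁ F N 0 0))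

include hβ0 hβ1 hg₃ hD h7

/-! ## The ADMISSIBLE reading of record (node00-def-W1 `ReadingData.ofRecordAdm`), the residual data `ne2`, `ne1` -/

section Admissible

variable
  (S : (F : T4Family) → (θ : Stage13HParams F N) → (k : ℕ) → ClusterTower (F.P k) (MatA N) θ.τ9.M)
  (sp : (F : T4Family) → (θ : Stage13HParams F N) → (k j : ℕ) → (domSys (F.P k) θ.τ9.M j).Dom → Set (CPair (F.P k) (MatA N)))
  (gauge : (F : T4Family) → (θ : Stage13HParams F N) → (k : ℕ) → GaugeField (F.P k) 0 (Node00.SU N) → GaugeField (F.P k) 0 (Node00.SU N) → ℝ)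
  (hg : ∀ (F : T4Family) (θ : Stage13HParams F N) (k : ℕ) (U U' : GaugeField (F.P k) 0 (Node00.SU N)), 0 ≤ gauge F θ k U U')
  (T₀ : (F : T4Family) → (θ : Stage13HParams F N) → (k : ℕ) → GaugeField (F.P (k + 1)) 0 (Node00.SU N) → GaugeField (F.P k) 0 (Node00.SU N))
  (hT₀ : ∀ (F : T4Family) (θ : Stage13HParams F N) (k : ℕ) (U : GaugeField (F.P (k + 1)) 0 (Node00.SU N)),
    (∀ (j : ℕ) (Y : (domSys (F.P (k + 1)) θ.τ9.M j).Dom), ofBackgroundC (ιSU N) U ∈ sp F θ (k + 1) j Y) →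
      ∀ (j : ℕ) (X : (domSys (F.P k) θ.τ9.M j).Dom), ofBackgroundC (ιSU N) (T₀ F θ k U) ∈ sp F θ k j X)
  (li : (F : T4Family) → Stage13HParams F N → LetterInputs)
  (ne2 : (F : T4Family) → Stage13HParams F N → (ℕ → ℝ) → List (ULoop F) → ℕ → NE2Objects₁₁)
  (ne1 : (F : T4Family) → Stage13HParams F N → (ℕ → ℝ) → List (ULoop F) → NE1pCarriers)

/-- ★★ **N27 = B5 AT THE REGIME RECORD CLASS, ANY `Rg`, AT THE ADMISSIBLE READING — EVERY K4 RATE SLOT IN ITS PRODUCER's DEEPEST LANDED CURRENCY, NODE N16 IN ITS CURRENCY OF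
RECORD R-β** ((N) §2's R-β twin over (Q) §2): N14 ⟸ END-B uniform leaves (dag-n14-c `s_N14_rRec₁₃CoPHOn_of_uniformLeaves`), N15 ⟸ `hne2` onto `c2BgObjects 3 F.hL b a_S α α' c₃₅ p`
(U-E, guarded), N16 AT EXPONENT `β` ⟸ §0 (40ᴮ §2), N17 eliminated, N18 in CLOSED FORM at θ, N22 ⟸ N18 (8a″ STRIP), (D4), K5 side, the N19′ edge reading `RatesHolderAt … β` ∀ ℓ₃.  At
`N = 2`, `Rg :=` the item's guard, THE ITEM (leaf F).  Every displayed antecedent is a HYPOTHESIS (0∕1 today); NE3 at exponent β NOT PROVED. [bookkeeping] -/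
theorem spine_rec13CCoPHOn_at_readingAdm₁₃CoPH_holder_of_uniformLeaves_c2Bg_thm33Letters (Rg : (F : T4Family) → Stage13HParams F N → Prop) {b aS : ℝ} (hb : 0 < b) (haS : 0 < aS) {c35 : ℝ} (hc35 : 0 < c35) (α α' : Fin 4) (p : ℝ)
    (h14 : ∀ (F : T4Family) (θ : Stage13HParams F N), θ.Provisos₁₃CoPH F N → Rg F θ → θ.Admissible F N → ∀ (g₀ : ℕ → ℝ) (os : List (ULoop F)),
      ∃ U : UniformConstants, U.Λ = (ne1 F θ g₀ os).Λ ∧ ∀ p K, Nonempty (BookingLeaves U ((ne1 F θ g₀ os).𝒯.B p K) ((ne1 F θ g₀ os).𝒯.T p K)))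
    (h18 : ∀ (F : T4Family) (θ : Stage13HParams F N), θ.Provisos₁₃CoPH F N → Rg F θ → θ.Admissible F N → ∀ (k : ℕ) (b : ℝ), 0 < b → b ≤ θ.γ →
      ∀ g ∈ Window θ.γ,
        ∀ (U : {U : GaugeField (F.P (k + 1)) 0 (Node00.SU N) //
            ∀ (j : ℕ) (Y : (domSys (F.P (k + 1)) θ.τ9.M j).Dom), ofBackgroundC (ιSU N) U ∈ sp F θ (k + 1) j Y})
          (X : Node00.W1.Dom (F.P k) θ.τ9.M),
        |(functionalC (S F θ k) g (ofBackgroundC (ιSU N) (T₀ F θ k U.1)) X).re -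
            (functionalC (S F θ (k + 1)) (prependCoupling b g) (ofBackgroundC (ιSU N) U.1) (pairOfRecord F θ.τ9.M k X)).re| ≤
          (li F θ).C₅ * (li F θ).θ₅ ^ X.1 * Real.exp (-((li F θ).κ * (domSys (F.P k) θ.τ9.M X.1).dj X.2)))
    -- N22 ⟸ N18 (dag-n22-e module 8a″, STRIP currency on the reading's OWN table, NO readings clause): (J), twelve numerals, STRIP-(1.18) — verbatim
    (hjunk : ∀ (F : T4Family) (θ : Stage13HParams F N), θ.Provisos₁₃CoPH F N → Rg F θ → θ.Admissible F N →
      ∀ (k : ℕ) (X : Node00.W1.Dom (F.P k) θ.τ9.M), k < X.1 → ∀ (g : ℕ → ℝ) (φ : CPair (F.P k) (MatA N)), functionalC (S F θ k) g φ X = 0)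
    (hnum : ∀ (F : T4Family) (θ : Stage13HParams F N), θ.Provisos₁₃CoPH F N → Rg F θ → θ.Admissible F N →
      0 < (li F θ).C₀ ∧ 0 < (li F θ).θ₅ ∧ (li F θ).θ₅ < 1 ∧ 0 ≤ (li F θ).C₅ ∧ 2 * (li F θ).C₅ / (1 - (li F θ).θ₅) ≤ (li F θ).C₀ ∧ 0 < (li F θ).A ∧
        (li F θ).θ₅ ≤ (li F θ).μ ∧ (li F θ).C₀ ≤ 2 * (li F θ).A ∧ 0 < (li F θ).r ∧ 0 < (li F θ).s ∧ (li F θ).s < 1 ∧ 1 ≤ (li F θ).μ)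
    (hstrip : ∀ (F : T4Family) (θ : Stage13HParams F N), θ.Provisos₁₃CoPH F N → Rg F θ → θ.Admissible F N → ∀ (k : ℕ),
      ∀ (j : ℕ) (g : ℕ → ℝ), g ∈ Window θ.γ → ∀ (i : ℕ) (Y : (domSys (F.P k) θ.τ9.M j).Dom) (ψ : CPair (F.P k) (MatA N)), ψ ∈ sp F θ k j Y →
        ∃ (Ec : ℂ → ℂ) (O : Set ℂ), IsOpen O ∧ (∀ t ∈ Ioc (0 : ℝ) θ.γ, closedBall (t : ℂ) (li F θ).r ⊆ O) ∧ DifferentiableOn ℂ Ec O ∧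
          (∀ z ∈ O, ‖Ec z‖ ≤ (li F θ).A * Real.exp (-((li F θ).κ * torusTreeLen Y.1))) ∧
          (∀ t ∈ Ioc (0 : ℝ) θ.γ, Ec t = termC (S F θ k) j Y (Function.update g i t) ψ))
    (hD4 : ∀ (F : T4Family) (θ : Stage13HParams F N) (hP : θ.Provisos₁₃CoPH F N), Rg F θ → θ.Admissible F N → ∀ k : ℕ,
      ReadOutAt (datumOfRecord₁₃CoPH F N θ hP) (u3OfRecord₁₃ θ.toStage13Params
        ((ReadingData.ofRecordAdm F θ.τ9.M N (S F θ) (sp F θ) (gauge F θ) (hg F θ) (T₀ F θ) (hT₀ F θ) (li F θ)).u3Objects θ.γ) k))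
    (h20 : S_N20 (SRec₁₃CoPHOn cr Rg)) (h21 : S_N21 (SRec₁₃CoPHOn cr Rg))
    (hx : ∀ (F : T4Family) (θ : Stage13HParams F N) (hP : θ.Provisos₁₃CoPH F N), Rg F θ → θ.Admissible F N →
      B16.EndStatementBPrinted (datumOfRecord₁₃CoPH F N θ hP).C → DagBinding.EndpointExistence (datumOfRecord₁₃CoPH F N θ hP).C.toB12 →
        ForSmallCouplings (datumOfRecord₁₃CoPH F N θ hP) fun g₀ => ∀ os : List (ULoop F),
          0 < (cr F θ hP g₀ os).l₀ ∧ 0 < (cr F θ hP g₀ os).vol ∧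
          (∀ (K : ℕ) (t : ℝ), |t| ≤ (cr F θ hP g₀ os).l₀ →
            T4GenFunBounds.schemeZ ((datumOfRecord₁₃CoPH F N θ hP).scheme g₀) os ((cr F θ hP g₀ os).K₀ + K) t =
              ∑ τ ∈ (cr F θ hP g₀ os).T K, (cr F θ hP g₀ os).A K t τ) ∧
          (∀ (K : ℕ) (t : ℝ), |t| ≤ (cr F θ hP g₀ os).l₀ →
            T4GenFunBounds.schemeZ ((datumOfRecord₁₃CoPH F N θ hP).scheme g₀) os ((cr F θ hP g₀ os).K₀ + K + 1) t =
              ∑ τ ∈ (cr F θ hP g₀ os).T K, (cr F θ hP g₀ os).B K t τ))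
    (h19 : ∀ (ℓ₃ : T4Family → NE3Letters₁₁) (F : T4Family) (θ : Stage13HParams F N) (hP : θ.Provisos₁₃CoPH F N), Rg F θ → θ.Admissible F N → ∀ (g₀ : ℕ → ℝ) (os : List (ULoop F)),
      (∀ k : ℕ, RatesHolderAt (datumOfRecord₁₃CoPH F N θ hP) (rateCarriersOfRecord₁₃CoPH (readingOfRecord₁₃CoPH
        (fun F θ => ReadingData.ofRecordAdm F θ.τ9.M N (S F θ) (sp F θ) (gauge F θ) (hg F θ) (T₀ F θ) (hT₀ F θ) (li F θ)) ℓ₃ ne2 ne1) F θ hP g₀ os k) β) →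
        letI := (cr F θ hP g₀ os).dec
        ∃ δ : ℕ → ℝ, NE7.Core (cr F θ hP g₀ os).l₀ (cr F θ hP g₀ os).vol (cr F θ hP g₀ os).T (cr F θ hP g₀ os).Bad
          (fun K t τ => (cr F θ hP g₀ os).A K t τ - (cr F θ hP g₀ os).shA K t τ) (fun K t τ => (cr F θ hP g₀ os).B K t τ - (cr F θ hP g₀ os).shB K t τ) δ ∧
          Summable δ)
    (hne2 : ∀ (F : T4Family) (θ : Stage13HParams F N), θ.Provisos₁₃CoPH F N → θ.Admissible F N → ∀ (g₀ : ℕ → ℝ) (os : List (ULoop F)) (k : ℕ),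
      ne2 F θ g₀ os k = haveI := neZero_blockFactor F; c2BgObjects 3 F.hL b aS α α' c35 p) :
    Spine (N := N) fun F D w => Node00.IsRecordOfRecord₁₃CCoPHOn F N Rg D w := by
  obtain ⟨ℓ₃, h16, -⟩ := exists_letters_s_N16Holder_readingOfRecord₁₃CoPHOn_of_thm33Letters_allTorus hβ0 hβ1 (Rg := Rg)
    (w1 := fun F θ => ReadingData.ofRecordAdm F θ.τ9.M N (S F θ) (sp F θ) (gauge F θ) (hg F θ) (T₀ F θ) (hT₀ F θ) (li F θ)) (ne2 := ne2) (ne1 := ne1) hg₃ hD h7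
  have h18' : S_N18 (RRec₁₃CoPHOn (readingOfRecord₁₃CoPH
      (fun F θ => ReadingData.ofRecordAdm F θ.τ9.M N (S F θ) (sp F θ) (gauge F θ) (hg F θ) (T₀ F θ) (hT₀ F θ) (li F θ)) ℓ₃ ne2 ne1) Rg) :=
    (s_N18_readingOfRecord₁₃CoPHOn_iff _ ℓ₃ ne2 ne1 Rg).mpr fun F θ hP hRg hθ k =>
      (n18At_u3OfRecord₁₃_readingAdm_iff θ.toStage13Params k (S F θ) (sp F θ) (gauge F θ) (hg F θ) (T₀ F θ) (hT₀ F θ) (li F θ)).mpr (h18 F θ hP hRg hθ k)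
  exact spine_rec13CCoPHOn_at_readingOfRecord₁₃CoPH_holder cr β _ ne2 ne1 Rg ℓ₃
    (s_N14_rRec₁₃CoPHOn_of_uniformLeaves _ Rg fun F θ hP hRg hθ g₀ os => h14 F θ hP hRg hθ g₀ os)
    (s_N15_readingOfRecord₁₃CoPHOn_of_c2Bg_family _ ℓ₃ ne2 ne1 hb haS hc35 α α' p hne2 Rg) h16
    h18' (s_N22_readingOfRecord₁₃CoPHOn_ofRecordAdm_of_s_N18_stripBound S sp gauge hg T₀ hT₀ li ℓ₃ ne2 ne1 Rg h18' hjunk hnum hstrip)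
    ((s_D4_rRec₁₃CoPHOn_iff _ Rg).mpr fun F θ hP hRg hθ _ _ k => hD4 F θ hP hRg hθ k) h20 h21 hx (h19 ℓ₃)

end Admissible

end Summit.QuantumFields.YangMills.Theorems.BalabanUVNodesN27SpineRecord
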